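import Literature.AlgebraicGeometry.Resolution.RsopMonomialIdeals
import Literature.AlgebraicGeometry.Resolution.RegularSystemOfParameters
import Literature.AlgebraicGeometry.Resolution.RegularLocalRingsProofs
import HarnessLib

/-!
# [OURS · L1 W4.6 rung (iii-2), piece (T)] Surface Moh window — LOCAL TOOLS: three-element regular systems of parameters and
# the regular quotients by one or two of them (cell res-hironaka, LADDER-RESOLUTION rung L, D-0089; unit res-L1-s46-pv-12 carried
# by res-D-pv-050; host MarkedTransfer, `--supports stmt-ResolutionOfSingularities-16155 --as helper`)

HONEST FRAMING. Nothing here is a statement of H. Hironaka's manuscript [Hironaka2017] and nothing here asserts that any statement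
of it holds. PURE COMMUTATIVE ALGEBRA (Matsumura 14.2 / Zariski–Samuel VIII §1 as already in the tree: `RsopMonomialIdeals`,
`RegularSystemOfParameters`, `RegularLocalOrder`, `RegularLocalRingsQuotient`), packaged in the shape the one-blow-up step of
rung (iii-2) «tame SURFACE Moh window» consumes (companion `…MohWindowSurfaceCore.lean`): for a regular local ring `L` of
embedding dimension `3` with `(u, v, w)` generating `𝔪` — `w ∉ (u, v) + 𝔪²` (minimality); `L/(u, v)` and `L/(u)` are regular with
the images of the remaining parameters outside `𝔪̄²`; images of `𝔪^k` and their pull-back; exact order of `unit · t^k`.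
AI-written; AI review is weaker than expert review. No `sorry`; axioms standard. [Matsumura1987] [ZariskiSamuel1960]
-/

noncomputable section

set_option linter.dupNamespace false -- mandated namespace of this single-conjunct summit

namespace Summit.ResolutionOfSingularities.ResolutionOfSingularities.Theorems.CampaignW46.MohWindowSurface

open IsLocalRing
open Literature.AlgebraicGeometry.Resolution

variable {L : Type*} [CommRing L]

/-! ## 1. Three-element regular systems of parameters -/

omit [CommRing L] in
/-- The range of a three-term vector is the three-element set. [folklore] -/
theorem range_vec3 (u v w : L) : Set.range ![u, v, w] = {u, v, w} := by
  ext a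
  simp only [Set.mem_range, Set.mem_insert_iff, Set.mem_singleton_iff]
  constructor
  · rintro ⟨i, rfl⟩
    fin_cases i <;> simp
  · rintro (rfl | rfl | rfl)
    exacts [⟨0, rfl⟩, ⟨1, rfl⟩, ⟨2, rfl⟩]

omit [CommRing L] in
/-- Cyclic rotation of a three-element set. [folklore] -/
theorem triple_rotate (u v w : L) : ({u, v, w} : Set L) = {v, w, u} := by
  ext a
  simp only [Set.mem_insert_iff, Set.mem_singleton_iff]
  tauto

omit [CommRing L] in
/-- Swap of the last two members of a three-element set. [folklore] -/
theorem triple_swap (u v w : L) : ({u, v, w} : Set L) = {u, w, v} := by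
  ext a
  simp only [Set.mem_insert_iff, Set.mem_singleton_iff]
  tauto

variable [IsRegularLocalRing L]

/-- Three generators of the maximal ideal of a regular local ring of embedding dimension `3` form a regular system
of parameters (a part of one, with nothing to add). [cite: Matsumura1987, Thm. 14.2] -/
theorem isRsopPart_vec3 (h3 : (maximalIdeal L).spanFinrank = 3) {u v w : L}
    (h : Ideal.span {u, v, w} = maximalIdeal L) : IsRsopPart ![u, v, w] := by
  have hx : Ideal.span (Set.range ![u, v, w]) = maximalIdeal L := by rw [range_vec3]; exact h
  have := isRsopPart_comp_of_rsop h3 ![u, v, w] hx id Function.injective_id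
  simpa using this

/-- **Minimality of a regular system of parameters `(u, v, w)`**: the third member is not in `(u, v) + 𝔪²` —
otherwise `(u, v, w − au − bv)` would be a regular system of parameters with a member in `𝔪²`.
[cite: Matsumura1987, Thm. 14.2] -/
theorem not_mem_span_pair_sup_sq (h3 : (maximalIdeal L).spanFinrank = 3) {u v w : L}
    (h : Ideal.span {u, v, w} = maximalIdeal L) : w ∉ Ideal.span {u, v} ⊔ maximalIdeal L ^ 2 := by
  intro hw
  obtain ⟨s, hs, q, hq, hsq⟩ := Submodule.mem_sup.mp hw
  obtain ⟨a, b, rfl⟩ := Ideal.mem_span_pair.mp hs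
  have hq' : q = w - (a * u + b * v) := by rw [← hsq]; ring
  have hu : u ∈ Ideal.span ({u, v, w} : Set L) := Ideal.subset_span (by simp)
  have hv : v ∈ Ideal.span ({u, v, w} : Set L) := Ideal.subset_span (by simp)
  have hw' : w ∈ Ideal.span ({u, v, w} : Set L) := Ideal.subset_span (by simp)
  have hu' : u ∈ Ideal.span ({u, v, q} : Set L) := Ideal.subset_span (by simp)
  have hv' : v ∈ Ideal.span ({u, v, q} : Set L) := Ideal.subset_span (by simp)
  have hq'' : q ∈ Ideal.span ({u, v, q} : Set L) := Ideal.subset_span (by simp)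
  -- the translated family `(u, v, q)` still generates `𝔪`
  have h' : Ideal.span {u, v, q} = maximalIdeal L := by
    rw [← h]
    apply le_antisymm
    · rw [Ideal.span_le]
      rintro c (rfl | rfl | rfl)
      · exact hu
      · exact hv
      · rw [SetLike.mem_coe, hq']
        exact Ideal.sub_mem _ hw' (Ideal.add_mem _ (Ideal.mul_mem_left _ _ hu) (Ideal.mul_mem_left _ _ hv))
    · rw [Ideal.span_le]
      rintro c (rfl | rfl | rfl)
      · exact hu'
      · exact hv'
      · have : c = q + (a * u + b * v) := by rw [hq']; ring
        rw [SetLike.mem_coe, this]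
        exact Ideal.add_mem _ hq'' (Ideal.add_mem _ (Ideal.mul_mem_left _ _ hu') (Ideal.mul_mem_left _ _ hv'))
  have hq2 : q ∉ maximalIdeal L ^ 2 := by
    have := (isRsopPart_vec3 h3 h').not_mem_sq 2
    simpa using this
  exact hq2 hq

/-! ## 2. Quotients by one or two of the three parameters -/

omit [IsRegularLocalRing L] in
/-- Images of `𝔪^k` lie in `𝔪̄^k` for a quotient of a local ring. [folklore] -/
theorem mk_mem_maximalIdeal_pow [IsLocalRing L] (I : Ideal L) [Nontrivial (L ⧸ I)] {a : L} {k : ℕ}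
    (ha : a ∈ maximalIdeal L ^ k) :
    haveI := IsLocalRing.of_surjective' (Ideal.Quotient.mk I) Ideal.Quotient.mk_surjective
    Ideal.Quotient.mk I a ∈ maximalIdeal (L ⧸ I) ^ k := by
  rw [maximalIdeal_quotient_eq_map I, ← Ideal.map_pow]
  exact Ideal.mem_map_of_mem _ ha

omit [IsRegularLocalRing L] in
/-- Images of elements of `𝔪` lie in `𝔪̄`. [folklore] -/
theorem mk_mem_maximalIdeal [IsLocalRing L] (I : Ideal L) [Nontrivial (L ⧸ I)] {a : L}
    (ha : a ∈ maximalIdeal L) :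
    haveI := IsLocalRing.of_surjective' (Ideal.Quotient.mk I) Ideal.Quotient.mk_surjective
    Ideal.Quotient.mk I a ∈ maximalIdeal (L ⧸ I) := by
  have := mk_mem_maximalIdeal_pow I (k := 1) (a := a) (by rw [pow_one]; exact ha)
  rwa [pow_one] at this

omit [IsRegularLocalRing L] in
/-- Conversely, an element whose image lies in `𝔪̄^k` lies in `I + 𝔪^k`. [folklore] -/
theorem mem_sup_pow_of_mk_mem [IsLocalRing L] (I : Ideal L) [Nontrivial (L ⧸ I)] {a : L} {k : ℕ}
    (ha : haveI := IsLocalRing.of_surjective' (Ideal.Quotient.mk I) Ideal.Quotient.mk_surjective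
      Ideal.Quotient.mk I a ∈ maximalIdeal (L ⧸ I) ^ k) :
    a ∈ I ⊔ maximalIdeal L ^ k := by
  rw [maximalIdeal_quotient_eq_map I, ← Ideal.map_pow,
    Ideal.mem_map_iff_of_surjective _ Ideal.Quotient.mk_surjective] at ha
  obtain ⟨c, hc, hca⟩ := ha
  have hac : a - c ∈ I := by rw [← Ideal.Quotient.eq, hca]
  have : a = (a - c) + c := by ring
  rw [this]
  exact Submodule.add_mem_sup hac hc

omit [IsRegularLocalRing L] in
/-- A quotient by an ideal inside `𝔪` is nontrivial. [folklore] -/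
theorem nontrivial_quotient_of_le [IsLocalRing L] {I : Ideal L} (hI : I ≤ maximalIdeal L) :
    Nontrivial (L ⧸ I) :=
  Ideal.Quotient.nontrivial_iff.mpr fun h => (maximalIdeal.isMaximal L).ne_top (top_le_iff.mp (h ▸ hI))

/-- **The quotient by two of three regular parameters** is a regular local ring (of dimension one) in which the
image of the third parameter is not in `𝔪̄²`. [cite: Matsumura1987, Thm. 14.2] -/
theorem quotient_pair (h3 : (maximalIdeal L).spanFinrank = 3) {u v w : L}
    (h : Ideal.span {u, v, w} = maximalIdeal L) :
    ∃ _ : IsRegularLocalRing (L ⧸ Ideal.span {u, v}),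
      Ideal.Quotient.mk (Ideal.span {u, v}) w ∉ maximalIdeal (L ⧸ Ideal.span {u, v}) ^ 2 := by
  classical
  have hx : Ideal.span (Set.range ![u, v, w]) = maximalIdeal L := by rw [range_vec3]; exact h
  have himg : (![u, v, w] '' (({0, 1} : Finset (Fin 3)) : Set (Fin 3))) = {u, v} := by
    ext a
    simp only [Finset.coe_insert, Finset.coe_singleton, Set.mem_image, Set.mem_insert_iff,
      Set.mem_singleton_iff]
    constructor
    · rintro ⟨i, rfl | rfl, rfl⟩ <;> simp
    · rintro (rfl | rfl)
      exacts [⟨0, Or.inl rfl, rfl⟩, ⟨1, Or.inr rfl, rfl⟩]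
  have hreg := isRegularLocalRing_quotient_span_image h3 ![u, v, w] hx {0, 1}
  rw [himg] at hreg
  refine ⟨hreg, fun hw2 => ?_⟩
  have hle : Ideal.span {u, v} ≤ maximalIdeal L := by
    rw [← h]; exact Ideal.span_mono (by intro a ha; rcases ha with rfl | rfl <;> simp)
  haveI := nontrivial_quotient_of_le hle
  exact not_mem_span_pair_sup_sq h3 h (mem_sup_pow_of_mk_mem _ hw2)

/-- **The quotient by one of three regular parameters** is a regular local ring (of dimension two) in which the
images of the other two parameters are not in `𝔪̄²`. [cite: Matsumura1987, Thm. 14.2] -/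
theorem quotient_single (h3 : (maximalIdeal L).spanFinrank = 3) {u v w : L}
    (h : Ideal.span {u, v, w} = maximalIdeal L) :
    ∃ _ : IsRegularLocalRing (L ⧸ Ideal.span {u}),
      Ideal.Quotient.mk (Ideal.span {u}) v ∉ maximalIdeal (L ⧸ Ideal.span {u}) ^ 2 ∧
        Ideal.Quotient.mk (Ideal.span {u}) w ∉ maximalIdeal (L ⧸ Ideal.span {u}) ^ 2 := by
  have hu : u ∈ maximalIdeal L := h ▸ Ideal.subset_span (by simp)
  -- `u ∉ 𝔪²`: apply the minimality lemma to the rotated system `(v, w, u)`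
  have hrot : Ideal.span {v, w, u} = maximalIdeal L := by rw [← triple_rotate]; exact h
  have hu2 : u ∉ maximalIdeal L ^ 2 := fun hu2 =>
    not_mem_span_pair_sup_sq h3 hrot (Ideal.mem_sup_right hu2)
  have hreg := (IsRegularLocalRing.quotient_span_singleton hu hu2).1
  have hle : Ideal.span {u} ≤ maximalIdeal L := by rw [Ideal.span_le]; simpa using hu
  haveI := nontrivial_quotient_of_le hle
  refine ⟨hreg, fun hv2 => ?_, fun hw2 => ?_⟩
  · -- `v ∉ (u) + 𝔪²`, from `v ∉ (u, w) + 𝔪²`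
    have hswap : Ideal.span {u, w, v} = maximalIdeal L := by rw [← triple_swap]; exact h
    have hle2 : Ideal.span {u} ⊔ maximalIdeal L ^ 2 ≤ Ideal.span {u, w} ⊔ maximalIdeal L ^ 2 :=
      sup_le_sup_right (Ideal.span_mono (Set.singleton_subset_iff.mpr (by simp))) _
    exact not_mem_span_pair_sup_sq h3 hswap (hle2 (mem_sup_pow_of_mk_mem _ hv2))
  · have hle2 : Ideal.span {u} ⊔ maximalIdeal L ^ 2 ≤ Ideal.span {u, v} ⊔ maximalIdeal L ^ 2 :=
      sup_le_sup_right (Ideal.span_mono (Set.singleton_subset_iff.mpr (by simp))) _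
    exact not_mem_span_pair_sup_sq h3 h (hle2 (mem_sup_pow_of_mk_mem _ hw2))

omit [IsRegularLocalRing L] in
/-- **Exact order of `unit · t^k`** for `t ∉ 𝔪²` in a regular local ring: it is not in `𝔪^{k+1}`.
[cite: ZariskiSamuel1960, Ch. VIII §1 Thm. 1] -/
theorem unit_mul_pow_not_mem_pow_succ {Q : Type*} [CommRing Q] [IsRegularLocalRing Q] {t c : Q}
    (ht : t ∉ maximalIdeal Q ^ 2) (hc : IsUnit c) (k : ℕ) : c * t ^ k ∉ maximalIdeal Q ^ (k + 1) := by
  have h1 : c ∉ maximalIdeal Q ^ (0 + 1) := by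
    rw [zero_add, pow_one]
    exact fun h => (maximalIdeal.isMaximal Q).ne_top (Ideal.eq_top_of_isUnit_mem _ h hc)
  have h2 : t ^ k ∉ maximalIdeal Q ^ (k * 1 + 1) :=
    pow_not_mem_pow_of_not_mem_pow (p := 1) (by simpa using ht) k
  rw [mul_one] at h2
  have := mul_not_mem_pow_of_not_mem_pow h1 h2
  simpa using this


end Summit.ResolutionOfSingularities.ResolutionOfSingularities.Theorems.CampaignW46.MohWindowSurface

end
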